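import Summits.ResolutionOfSingularities.ResolutionOfSingularities.Theorems.EquisingularLiftEquisingularLiftNatCarrierDeltaStalks
import Summits.ResolutionOfSingularities.ResolutionOfSingularities.Theorems.EquisingularLiftEquisingularLiftNatRegularOfSpecialFibre
import Literature.AlgebraicGeometry.Resolution.NagataCriterion
import Literature.AlgebraicGeometry.Resolution.BlowupsProperProofs
import HarnessLib

/-!
# [OURS · L1 W4.5(b)] T-CARRIER-Δ, scheme level (3/3): the Δ-centre `St_τ(K) ⊔ E` is REGULAR when the localised
# Δ-curve rings at its special points are (claim (ii))

Support file of the crux chain w45b (cell `res-hironaka`, LADDER-RESOLUTION rung L, slot W4.5(b)), working crux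
**EL♮ = `Theses.EquisingularLift.EquisingularLiftNat`** (stmt-ResolutionOfSingularities-20038), registered stub
`stub_elnat_three_isolated_nonabs`; target **T-CARRIER-Δ** of res-L1-w45b-lead-2 (TARGETS 2026-08-27 (2)), claim (ii):
«`V(C)` regular iff the Δ-criterion holds at every special point» for the Δ-centre `C := St_τ(K) ⊔ E` — clause (b)
`IsRegular C.subscheme` of a HorizChainE1 step, consumed by res-D-pv-013's T-Δ-ISO. OURS; NOT a statement of any
manuscript; AI-written, weaker than expert review. Filed `--supports stmt-ResolutionOfSingularities-20038 --as helper`.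

WHAT IS PROVED. Regularity of `V(C)` is decided at its points over the closed point `s₀` (res-type-032,
`Scheme.isRegular_subscheme_of_forall_over_closedPoint`, p504250; `V(C) → Spec O` is proper), all of which lie over
`s(s₀)` (E1 locator, p509910); there `𝒪_{V(C),x'} = 𝒪_{X₁,x'}/C_{x'}` with `C_{x'} = (Φ(c/c_j), c_j/1)·𝒪_{X₁,x'}`
(`exists_stalk_strictTransformIdeal_sup_comap`), i.e. (localisation commutes with quotients, tree
`isRegularLocalRing_localization_quotient_iff`) the localisation of `R[I/c_j]/(Φ(c/c_j), c_j) ≅ (R/(c))[T_l : l ≠ j]/(Φ̄_j)`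
(`exists_quotient_coneTransform_sup_equiv`, p508912) at a prime containing `ϖ̄_R` — the local ring of the Δ-CURVE
`(R/(c))[T₁, T₂]/(Φ̄_j)` over the DVR `R/(c) ≅ O` at a point of its special fibre. HENCE:

* **`isRegular_carrierDelta_subscheme`** — if for every chart `j` every localisation of `Λ[T_l : l ≠ j]/(Φ̄_j^θ)`
  (`θ : R/(c) ≅ Λ`; the section gives `Λ = O`) at a prime containing `C(θ ϖ̄_R)` is a regular local ring (the OUTPUT SHAPE
  of D1 (iii) `deltaRegularGeneric`, p502482, i.e. the Δ-criterion «`ḡ ∉ 𝔪_z²` or the `ϖ`-coefficient is a unit at `z`»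
  discharged there for generic `u`), then `V(C)` is a regular scheme;
* `isRegularLocalRing_stalk_quotient_carrierDelta` — the point-wise statement at a point of the Δ-centre over `supp J`
  (any blow-up `τ` along `J`, cone hypothesis at `𝒪_{X,τ x'}`); ring-level transports
  `isRegularLocalRing_localization_map_of_deltaCriterion` (Δ-criterion in `Λ`-currency ⇒ regularity of `(B/𝔞)_{𝔔/𝔞}`
  through any `B/𝔞 ≅ (R/(c))[T]/(Φ̄_j)`), `isRegularLocalRing_quotient_map_of_isLocalization` (localisation commutes with
  quotients for an abstract localisation), `nonempty_ringEquiv_localization_atPrime_comap_symm`.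

References: The Stacks Project, Tags 0804, 0BIQ; Q. Liu, *Algebraic Geometry and Arithmetic Curves* (2002), 4.2.
-/

set_option linter.dupNamespace false -- mandated namespace `Summit.<Summit>.<Problem>` of this single-conjunct summit
set_option linter.overlappingInstances false -- signatures carry `[IsDomain O] [IsDiscreteValuationRing O]`

noncomputable section

open CategoryTheory AlgebraicGeometry TopologicalSpace IsLocalRing Opposite
open Literature.AlgebraicGeometry.Resolution
open Summit.ResolutionOfSingularities.ResolutionOfSingularities.Cruxes.EquisingularLift.StrataSplit

namespace Summit.ResolutionOfSingularities.ResolutionOfSingularities.Cruxes.EquisingularLiftNat.Sections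

universe u

/-! ## Ring level: localisations at corresponding primes of isomorphic rings -/

section RingLevel

/-- Localisations of isomorphic rings at corresponding primes are isomorphic: for `ε : A ≃+* A'` and a prime `𝔮` of
`A`, `A_𝔮 ≅ A'_{ε(𝔮)}` (`ε(𝔮) = ε⁻¹⁻¹(𝔮)` as a `comap`). [folklore] -/
theorem nonempty_ringEquiv_localization_atPrime_comap_symm {A A' : Type*} [CommRing A] [CommRing A'] (ε : A ≃+* A')
    (𝔮 : Ideal A) [𝔮.IsPrime] :
    Nonempty (Localization.AtPrime 𝔮 ≃+* Localization.AtPrime (𝔮.comap ε.symm.toRingHom)) := by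
  refine ⟨IsLocalization.ringEquivOfRingEquiv (M := 𝔮.primeCompl) (T := (𝔮.comap ε.symm.toRingHom).primeCompl)
    (Localization.AtPrime 𝔮) (Localization.AtPrime (𝔮.comap ε.symm.toRingHom)) ε ?_⟩
  ext y
  simp only [Submonoid.mem_map]
  constructor
  · rintro ⟨x, hx, rfl⟩ hy
    exact hx (by simpa [Ideal.mem_comap] using hy)
  · intro hy
    exact ⟨ε.symm y, fun h => hy (by simpa [Ideal.mem_comap] using h), by simp⟩


/-- Localisation commutes with quotients, for an abstract localisation `S` of `B` at the prime `𝔔 ⊇ 𝔞`: if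
`(B/𝔞)_{𝔔/𝔞}` is a regular local ring then so is `S/𝔞S` (tree `isRegularLocalRing_localization_quotient_iff` for the
model `B_𝔔`, transported along `S ≅ B_𝔔`). [folklore] -/
theorem isRegularLocalRing_quotient_map_of_isLocalization {B S : Type*} [CommRing B] [CommRing S] [Algebra B S]
    (𝔔 : Ideal B) [𝔔.IsPrime] [IsLocalization.AtPrime S 𝔔] (𝔞 : Ideal B) (h𝔞𝔔 : 𝔞 ≤ 𝔔)
    [(𝔔.map (Ideal.Quotient.mk 𝔞)).IsPrime]
    (hreg : IsRegularLocalRing (Localization.AtPrime (𝔔.map (Ideal.Quotient.mk 𝔞)))) :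
    IsRegularLocalRing (S ⧸ 𝔞.map (algebraMap B S)) := by
  haveI := (isRegularLocalRing_localization_quotient_iff 𝔞 𝔔 h𝔞𝔔).mpr hreg
  let η : S ≃ₐ[B] Localization.AtPrime 𝔔 := IsLocalization.algEquiv 𝔔.primeCompl S (Localization.AtPrime 𝔔)
  have hmap : 𝔞.map (algebraMap B (Localization.AtPrime 𝔔)) = (𝔞.map (algebraMap B S)).map (η : S →+* _) := by
    rw [Ideal.map_map]
    congr 1
    ext b
    simp
  exact IsRegularLocalRing.of_ringEquiv (Ideal.quotientEquiv _ _ η.toRingEquiv hmap).symm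

variable {R : Type u} [CommRing R] {r : ℕ} (c : Fin r → R) (j : Fin r)

/-- **Transport of the Δ-criterion.** Let `θ : R/(c) ≅ Λ` (in use: `Λ = O` via the section), `B` a ring with an ideal
`𝔞` and `ε₀ : B/𝔞 ≅ (R/(c))[T_l : l ≠ j]/(Φ̄_j)` sending the class of `b₀` to the class of `C ϖ̄_R` (in use: `B = R[I/c_j]`,
`𝔞 = (Φ(c/c_j), c_j/1)`, `b₀ = ϖ_R/1`, `ε₀` from `exists_quotient_coneTransform_sup_equiv`, p508912). If every
localisation of `Λ[T_l : l ≠ j]/(Φ̄_j^θ)` at a prime containing `C(θ ϖ̄_R)` is a regular local ring, then for every prime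
`𝔔 ∋ b₀` of `B` with `𝔔/𝔞` prime the localisation of `B/𝔞` at `𝔔/𝔞` is regular. [folklore] -/
theorem isRegularLocalRing_localization_map_of_deltaCriterion (Φ : MvPolynomial (Fin r) R) (ϖR : R)
    {Λ : Type u} [CommRing Λ] (θ : (R ⧸ Ideal.span (Set.range c)) ≃+* Λ)
    (hreg : ∀ (𝔓 : Ideal (MvPolynomial {l : Fin r // l ≠ j} Λ ⧸ Ideal.span {MvPolynomial.map
        (θ.toRingHom.comp (Ideal.Quotient.mk (Ideal.span (Set.range c)))) (dehomogenize j Φ)})) [𝔓.IsPrime],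
      Ideal.Quotient.mk _ (MvPolynomial.C (θ (Ideal.Quotient.mk _ ϖR))) ∈ 𝔓 →
        IsRegularLocalRing (Localization.AtPrime 𝔓))
    {B : Type u} [CommRing B] (𝔞 : Ideal B) (b₀ : B)
    (ε₀ : (B ⧸ 𝔞) ≃+* (MvPolynomial {l : Fin r // l ≠ j} (R ⧸ Ideal.span (Set.range c)) ⧸
      Ideal.span {MvPolynomial.map (Ideal.Quotient.mk (Ideal.span (Set.range c))) (dehomogenize j Φ)}))
    (hε₀ : ε₀ (Ideal.Quotient.mk 𝔞 b₀) =
      Ideal.Quotient.mk _ (MvPolynomial.C (Ideal.Quotient.mk (Ideal.span (Set.range c)) ϖR)))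
    (𝔔 : Ideal B) [(𝔔.map (Ideal.Quotient.mk 𝔞)).IsPrime] (hb₀ : b₀ ∈ 𝔔) :
    IsRegularLocalRing (Localization.AtPrime (𝔔.map (Ideal.Quotient.mk 𝔞))) := by
  -- `(R/(c))[T]/(Φ̄_j) ≅ Λ[T]/(Φ̄_j^θ)` along `θ`
  let μ : MvPolynomial {l : Fin r // l ≠ j} (R ⧸ Ideal.span (Set.range c)) ≃+*
      MvPolynomial {l : Fin r // l ≠ j} Λ := MvPolynomial.mapEquiv {l : Fin r // l ≠ j} θ
  have hμ : ∀ F, μ F = MvPolynomial.map (θ : _ →+* Λ) F := fun F => rfl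
  have hμspan : Ideal.span {MvPolynomial.map (θ.toRingHom.comp (Ideal.Quotient.mk (Ideal.span (Set.range c))))
      (dehomogenize j Φ)} = (Ideal.span {MvPolynomial.map (Ideal.Quotient.mk (Ideal.span (Set.range c)))
        (dehomogenize j Φ)}).map (μ : _ →+* _) := by
    rw [Ideal.map_span, Set.image_singleton]
    change _ = Ideal.span {μ _}
    rw [hμ, MvPolynomial.map_map]
    rfl
  let ε' := Ideal.quotientEquiv _ _ μ hμspan
  let ε'' := ε₀.trans ε'
  obtain ⟨e₃⟩ := nonempty_ringEquiv_localization_atPrime_comap_symm ε'' (𝔔.map (Ideal.Quotient.mk 𝔞))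
  -- `C(θ ϖ̄_R) ∈ 𝔓 := ε''(𝔔/𝔞)`
  have hmem : Ideal.Quotient.mk _ (MvPolynomial.C (θ (Ideal.Quotient.mk _ ϖR))) ∈
      (𝔔.map (Ideal.Quotient.mk 𝔞)).comap ε''.symm.toRingHom := by
    have h1 : ε'' (Ideal.Quotient.mk 𝔞 b₀) = Ideal.Quotient.mk _ (MvPolynomial.C (θ (Ideal.Quotient.mk _ ϖR))) := by
      change ε' (ε₀ _) = _
      rw [hε₀]
      change Ideal.quotientEquiv _ _ μ hμspan (Ideal.Quotient.mk _ _) = _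
      rw [Ideal.quotientEquiv_mk]
      change Ideal.Quotient.mk _ (μ _) = _
      rw [hμ, MvPolynomial.map_C]
      rfl
    rw [Ideal.mem_comap, ← h1]
    change ε''.symm (ε'' _) ∈ _
    rw [RingEquiv.symm_apply_apply]
    exact Ideal.mem_map_of_mem _ hb₀
  haveI := hreg _ hmem
  exact IsRegularLocalRing.of_ringEquiv e₃.symm

end RingLevel

/-! ## Stalk level: `𝒪_{X',x'}/C_{x'}` is a localised Δ-curve ring -/

section Stalk

variable {X X' : Scheme.{u}} {τ : X' ⟶ X} {J : X.IdealSheafData}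

/-- **The local ring of the Δ-centre at a point over the old centre is regular as soon as the localised Δ-curve rings
are.** Setting of `exists_stalk_strictTransformIdeal_sup_comap` (blow-up `τ` along `J`, `X'` locally Noetherian,
`τ x' = p ∈ supp J`, cone hypothesis at `R = 𝒪_{X,p}`), `x'` a point of `C = St_τ(K) ⊔ J·𝒪_{X'}`, `ϖ_R ∈ 𝔪_R` the germ
of a global section `v`, `θ : R/(c) ≅ Λ`. IF for every chart `j` every localisation of `Λ[T_l : l ≠ j]/(Φ̄_j^θ)` at a prime
containing `C(θ ϖ̄_R)` is a regular local ring (the OUTPUT SHAPE of D1 (iii) `deltaRegularGeneric` with `Λ = O`), THEN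
`𝒪_{X',x'}/C_{x'}` is a regular local ring: it is `≅ (R[I/c_j])_𝔔/𝔞 ≅` (localisation commutes with quotients,
`isRegularLocalRing_localization_quotient_iff`) the localisation of `R[I/c_j]/𝔞` at `𝔔/𝔞`, `𝔞 = (Φ(c/c_j), c_j/1) ⊆ 𝔔`.
[folklore] -/
theorem isRegularLocalRing_stalk_quotient_carrierDelta [IsLocallyNoetherian X'] (hτ : IsBlowup τ J)
    (K : X.IdealSheafData) (x' : X') (p : X) (hp : τ x' = p) (hpJ : p ∈ (J.support : Set X)) {r : ℕ}
    (c : Fin r → X.presheaf.stalk p) (hcJ : Ideal.span (Set.range c) = stalkIdeal J p)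
    (hc : IsQuasiRegular c) [IsDomain (X.presheaf.stalk p ⧸ Ideal.span (Set.range c))]
    {d : ℕ} (Φ : MvPolynomial (Fin r) (X.presheaf.stalk p)) (hΦd : Φ.IsHomogeneous d)
    (hΦ : MvPolynomial.map (Ideal.Quotient.mk (Ideal.span (Set.range c))) Φ ≠ 0)
    (hK : stalkIdeal K p = Ideal.span {MvPolynomial.eval c Φ}) (v : Γ(X, ⊤))
    (hϖ𝔪 : (X.presheaf.Γgerm p).hom v ∈ maximalIdeal (X.presheaf.stalk p))
    {Λ : Type u} [CommRing Λ] (θ : (X.presheaf.stalk p ⧸ Ideal.span (Set.range c)) ≃+* Λ)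
    (hreg : ∀ (j : Fin r) (𝔓 : Ideal (MvPolynomial {l : Fin r // l ≠ j} Λ ⧸ Ideal.span {MvPolynomial.map
        (θ.toRingHom.comp (Ideal.Quotient.mk (Ideal.span (Set.range c)))) (dehomogenize j Φ)})) [𝔓.IsPrime],
      Ideal.Quotient.mk _ (MvPolynomial.C (θ (Ideal.Quotient.mk _ ((X.presheaf.Γgerm p).hom v)))) ∈ 𝔓 →
        IsRegularLocalRing (Localization.AtPrime 𝔓))
    (hx' : x' ∈ (strictTransformIdeal τ J K ⊔ J.comap τ).support) :
    IsRegularLocalRing (X'.presheaf.stalk x' ⧸ stalkIdeal (strictTransformIdeal τ J K ⊔ J.comap τ) x') := by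
  subst hp
  obtain ⟨j, 𝔔, χ, e, hχ, he, h𝔔, -, -, hC, hiff⟩ :=
    exists_stalk_strictTransformIdeal_sup_comap hτ K x' hpJ c hcJ hc Φ hΦd hΦ hK
  letI := χ.toAlgebra
  haveI : IsLocalization.AtPrime (X'.presheaf.stalk x') 𝔔.asIdeal := isLocalization_stalk_of_ringEquiv 𝔔 x' χ e he
  -- `𝔞 = (Φ(c/c_j), c_j/1) ⊆ 𝔔`, `ϖ_R/1 ∈ 𝔔`
  have hG'𝔔 : MvPolynomial.aeval (blowupAlgebra.frac c j) Φ ∈ 𝔔.asIdeal := hiff.mp hx'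
  have ht𝔔 : algebraMap _ (blowupAlgebra (Ideal.span (Set.range c)) (c j)) (c j) ∈ 𝔔.asIdeal := by
    rw [← Ideal.mem_comap, h𝔔]
    have h := (mem_support_iff_stalkIdeal_le J (τ x')).mp hpJ
    rw [← hcJ] at h
    exact h (Ideal.subset_span (Set.mem_range_self j))
  have h𝔞𝔔 : Ideal.span {MvPolynomial.aeval (blowupAlgebra.frac c j) Φ} ⊔
      Ideal.span {algebraMap _ (blowupAlgebra (Ideal.span (Set.range c)) (c j)) (c j)} ≤ 𝔔.asIdeal :=
    sup_le ((Ideal.span_singleton_le_iff_mem _).mpr hG'𝔔) ((Ideal.span_singleton_le_iff_mem _).mpr ht𝔔)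
  have hϖ𝔔 : algebraMap _ (blowupAlgebra (Ideal.span (Set.range c)) (c j)) ((X.presheaf.Γgerm (τ x')).hom v) ∈
      𝔔.asIdeal := by
    rw [← Ideal.mem_comap, h𝔔]; exact hϖ𝔪
  -- `C_{x'} = 𝔞 · 𝒪_{X',x'}`
  have hCmap : stalkIdeal (strictTransformIdeal τ J K ⊔ J.comap τ) x' =
      (Ideal.span {MvPolynomial.aeval (blowupAlgebra.frac c j) Φ} ⊔
        Ideal.span {algebraMap _ (blowupAlgebra (Ideal.span (Set.range c)) (c j)) (c j)}).map
        (algebraMap (blowupAlgebra (Ideal.span (Set.range c)) (c j)) (X'.presheaf.stalk x')) := by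
    rw [hC, Ideal.map_sup, Ideal.map_span, Ideal.map_span, Set.image_singleton, Set.image_singleton]
    rfl
  -- `𝔔/𝔞` is prime; the Δ-criterion transported along p508912's `ε₀`; localisation commutes with quotients
  haveI : (𝔔.asIdeal.map (Ideal.Quotient.mk (Ideal.span {MvPolynomial.aeval (blowupAlgebra.frac c j) Φ} ⊔
      Ideal.span {algebraMap _ (blowupAlgebra (Ideal.span (Set.range c)) (c j)) (c j)}))).IsPrime :=
    Ideal.map_isPrime_of_surjective Ideal.Quotient.mk_surjective (by rw [Ideal.mk_ker]; exact h𝔞𝔔)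
  obtain ⟨ε₀, hε₀a, -⟩ := exists_quotient_coneTransform_sup_equiv c j hc Φ
  have hreg' := isRegularLocalRing_localization_map_of_deltaCriterion c j Φ _ θ (hreg j) _ _ ε₀ (hε₀a _)
    𝔔.asIdeal hϖ𝔔
  have hS := isRegularLocalRing_quotient_map_of_isLocalization (S := X'.presheaf.stalk x') 𝔔.asIdeal _ h𝔞𝔔 hreg'
  rw [← hCmap] at hS
  exact hS

end Stalk

/-! ## Claim (ii): the Δ-centre is a regular scheme -/

section Regular

variable (O : Type) [CommRing O] [IsDomain O] [IsDiscreteValuationRing O]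

/-- **CLAIM (ii) of T-CARRIER-Δ / clause (b) of a HorizChainE1 step: the Δ-centre is a REGULAR scheme when the Δ-criterion
holds along its special fibre.** Let `O` be a DVR, `q : P → Spec O` proper (`P` locally Noetherian), `s` a section,
`τ : X₁ → P` a blow-up along `ker s` (`X₁` locally Noetherian), `K` an ideal sheaf on `P`; at `R = 𝒪_{P,s(s₀)}`:
`(ker s)_{s(s₀)} = (c)` with `c` quasi-regular, `θ : R/(c) ≅ Λ` (the section: `Λ = O`), `K_{s(s₀)} = (Φ(c))` for a form
`Φ` of degree `d` with `Φ mod (c) ≠ 0`, and `ϖ_R ∈ 𝔪_R` the germ of `q^* ϖ`. IF for every chart `j` and every prime `𝔓`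
of the Δ-curve ring `Λ[T_l : l ≠ j]/(Φ̄_j^θ)` containing `C(θ ϖ̄_R)` (= the points of its special fibre when `θ ϖ̄_R` is
the uniformizer of `Λ = O`) the local ring at `𝔓` is regular — the conclusion of D1 (iii) `deltaRegularGeneric`
(p502482) — THEN `V(St_τ(K) ⊔ (ker s)·𝒪_{X₁})` is a regular scheme (regularity spreads from the points over `s₀`,
res-type-032 p504250; those lie over `s(s₀)`, p509910; there `isRegularLocalRing_stalk_quotient_carrierDelta`).
[cite: Liu2002, Thm. 8.1.19 (a)] -/
theorem isRegular_carrierDelta_subscheme {P X₁ : Scheme.{0}} [IsLocallyNoetherian P] (q : P ⟶ Spec (.of O))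
    [IsProper q] (s : Spec (.of O) ⟶ P) (hs : s ≫ q = 𝟙 _) (τ : X₁ ⟶ P) (hτ : IsBlowup τ s.ker)
    [IsLocallyNoetherian X₁] (K : P.IdealSheafData) {r : ℕ}
    (c : Fin r → P.presheaf.stalk (s (IsLocalRing.closedPoint O)))
    (hcJ : Ideal.span (Set.range c) = stalkIdeal s.ker (s (IsLocalRing.closedPoint O))) (hc : IsQuasiRegular c)
    [IsDomain (P.presheaf.stalk (s (IsLocalRing.closedPoint O)) ⧸ Ideal.span (Set.range c))] {d : ℕ}
    (Φ : MvPolynomial (Fin r) (P.presheaf.stalk (s (IsLocalRing.closedPoint O)))) (hΦd : Φ.IsHomogeneous d)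
    (hΦ : MvPolynomial.map (Ideal.Quotient.mk (Ideal.span (Set.range c))) Φ ≠ 0)
    (hK : stalkIdeal K (s (IsLocalRing.closedPoint O)) = Ideal.span {MvPolynomial.eval c Φ}) (ϖ : O)
    (hϖ𝔪 : (P.presheaf.Γgerm (s (IsLocalRing.closedPoint O))).hom (q.appTop.hom ((Scheme.ΓSpecIso (.of O)).inv.hom ϖ)) ∈
      maximalIdeal (P.presheaf.stalk (s (IsLocalRing.closedPoint O))))
    {Λ : Type} [CommRing Λ] (θ : (P.presheaf.stalk (s (IsLocalRing.closedPoint O)) ⧸ Ideal.span (Set.range c)) ≃+* Λ)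
    (hreg : ∀ (j : Fin r) (𝔓 : Ideal (MvPolynomial {l : Fin r // l ≠ j} Λ ⧸ Ideal.span {MvPolynomial.map
        (θ.toRingHom.comp (Ideal.Quotient.mk (Ideal.span (Set.range c)))) (dehomogenize j Φ)})) [𝔓.IsPrime],
      Ideal.Quotient.mk _ (MvPolynomial.C (θ (Ideal.Quotient.mk _ ((P.presheaf.Γgerm (s (IsLocalRing.closedPoint O))).hom
        (q.appTop.hom ((Scheme.ΓSpecIso (.of O)).inv.hom ϖ)))))) ∈ 𝔓 → IsRegularLocalRing (Localization.AtPrime 𝔓)) :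
    Scheme.IsRegular (strictTransformIdeal τ s.ker K ⊔ s.ker.comap τ).subscheme := by
  haveI : IsSeparated q := inferInstance
  haveI : IsProper τ := hτ.isProper
  haveI : UniversallyClosed ((strictTransformIdeal τ s.ker K ⊔ s.ker.comap τ).subschemeι ≫ τ ≫ q) := inferInstance
  refine Scheme.isRegular_subscheme_of_forall_over_closedPoint (τ ≫ q) _ fun x' hx'C hq => ?_
  -- the point lies over `s(s₀)`
  obtain ⟨t, ht⟩ := image_support_carrierDelta_subset_range O q s hs τ K ⟨_, hx'C, rfl⟩
  have hcomp : ∀ t', q (s t') = t' := fun t' => by rw [← Scheme.Hom.comp_apply, hs]; rfl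
  have hq' : q (τ x') = IsLocalRing.closedPoint O := by rw [← Scheme.Hom.comp_apply]; exact hq
  have htt : t = IsLocalRing.closedPoint O := by rw [← hcomp t, ht]; exact hq'
  rw [htt] at ht
  exact isRegularLocalRing_stalk_quotient_carrierDelta hτ K x' (s (IsLocalRing.closedPoint O)) ht.symm
    (by rw [ht]; exact image_support_strictTransformIdeal_sup_comap_subset τ s.ker K ⟨_, hx'C, rfl⟩)
    c hcJ hc Φ hΦd hΦ hK (q.appTop.hom ((Scheme.ΓSpecIso (.of O)).inv.hom ϖ)) hϖ𝔪 θ hreg hx'C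

end Regular

end Summit.ResolutionOfSingularities.ResolutionOfSingularities.Cruxes.EquisingularLiftNat.Sections

end
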